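import Mathlib
import Summits.ValiantsHypothesis.ValiantsHypothesis.Theorems.BarrierLeverPartitionMinorsHitByVPHiddenStatesJoinAbsorb
import Summits.ValiantsHypothesis.ValiantsHypothesis.Theorems.BarrierLeverPartitionMinorsHitByVPSimplexJoinUniform
import Summits.ValiantsHypothesis.ValiantsHypothesis.Theorems.BarrierLeverPartitionMinorsHitByVPStubJoinDoorWide

/-!
# Route BarrierLever — item `PartitionMinorsHitByVP` (stmt-ValiantsHypothesis-19717):
# UNIFORM PIECES COMPOSE in the WIDE JOIN door (line `hidden_states`, node `stub_universalJoinWide`)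

Helper file (`--supports stmt-ValiantsHypothesis-19717`; cell valiant-natproofs, rung V4, 𝒟-side door (c), line
`hidden_states`; prover seat val-np-p3 gen 11). Definition-free. Closes NO item.

The wide join door's `u`-side matrix of a design `e : Fin r → Fin m × Finset (Fin K)` (piece, state set) with tables
`T : Fin m → Option (Fin K) → Fin h → ℂ` is `[∏_{a ∈ u i} (T p none a + Σ_{q ∈ J} T p (some q) a)]`, column `k ↦ (p, J) = e k`.
A piece `p` is UNIFORM when for EVERY injective row family `v` of as many subsets of `Fin h` as `p` has columns some table of
`p` makes its block nonsingular. **`good_of_uniform_pieces_join`**: if every piece is uniform then for every injective `u` some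
table makes the whole matrix nonsingular — strong induction on `r` via the absorption theorem `good_of_absorb_join`
(`…HiddenStatesJoinAbsorb`) along binary row weights, exactly as `SimplexJoin.good_of_uniform_pieces` for the simplex-product
door. **`partitionMinor_hit_of_uniformJoin`**: hence a LEGAL wide design (`m ≤ 2h` pieces, `K ≤ h³` states, join threshold
family) all of whose pieces are uniform serves EVERY injective pair `(u, w)` of its size inside `SmallCircuits ℂ (h+h) 8`
(`HiddenStatesLine.stub_joinDoorWide`). So the node `Stmt.universalJoinWide` follows from the uniformity of the pieces of ONE
legal design per `(h, r)` — e.g. joins of complete balls on `h² ≤ K_p ≤ h³` states (seat memo §9–§10: complete balls with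
`K = h` die at `h = 9` by a packing class, wide ones pass every count). WHAT THIS IS NOT: no piece is proved uniform here;
item 19717 stays OPEN; nothing on crux 14610 or VP ≠ VNP.
-/

set_option linter.dupNamespace false

namespace Summit.ValiantsHypothesis.ValiantsHypothesis.Theorems.BarrierLever.SimplexJoin

open Finset Matrix

/-- **UNIFORM PIECES COMPOSE (wide join door).** If every piece `p` of the design `e` is uniform — every bijective
enumeration `c` of its columns has, for EVERY injective row family `v` of the same size, a table making the block
`[∏_{a ∈ v x} (t none a + Σ_{q ∈ (e (c x')).2} t (some q) a)]` nonsingular — then for every injective `u : Fin r → Finset (Fin h)`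
some table `T` makes the whole `u`-side matrix of the design nonsingular. -/
theorem good_of_uniform_pieces_join (h m K r : ℕ) (u : Fin r → Finset (Fin h))
    (e : Fin r → Fin m × Finset (Fin K)) (hu : Function.Injective u) (he : Function.Injective e)
    (hU : ∀ (p : Fin m) (n : ℕ) (c : Fin n → Fin r), Function.Injective c → (∀ x, (e (c x)).1 = p) →
      (∀ k, (e k).1 = p → ∃ x, c x = k) → ∀ v : Fin n → Finset (Fin h), Function.Injective v →
        ∃ t : Option (Fin K) → Fin h → ℂ,
          (Matrix.of fun x x' : Fin n => ∏ a ∈ v x,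
            (t none a + ∑ q ∈ (e (c x')).2, t (some q) a)).det ≠ 0) :
    ∃ T : Fin m → Option (Fin K) → Fin h → ℂ,
      (Matrix.of fun i k : Fin r => ∏ a ∈ u i,
        (T (e k).1 none a + ∑ q ∈ (e k).2, T (e k).1 (some q) a)).det ≠ 0 := by
  induction r using Nat.strong_induction_on with
  | _ r ih =>
  rcases Nat.eq_zero_or_pos r with hr | hr
  · subst hr
    exact ⟨fun _ _ _ => 0, by rw [Matrix.det_isEmpty]; exact one_ne_zero⟩
  set p₀ : Fin m := (e ⟨0, hr⟩).1 with hp₀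
  set n : ℕ := Fintype.card {k : Fin r // (e k).1 = p₀} with hn
  set n' : ℕ := Fintype.card {k : Fin r // ¬ (e k).1 = p₀} with hn'
  have hnr : n ≤ r := by simpa using Fintype.card_subtype_le (fun k : Fin r => (e k).1 = p₀)
  have hn'r : n' = r - n := by simp [hn', hn, Fintype.card_subtype_compl]
  have hnpos : 0 < n := Fintype.card_pos_iff.mpr ⟨⟨⟨0, hr⟩, rfl⟩⟩
  have hnn' : n + n' = r := by omega
  have hlt : n' < r := by omega
  let ec : Fin n ⊕ Fin n' ≃ Fin r :=
    (Equiv.sumCongr (Fintype.equivFin {k : Fin r // (e k).1 = p₀}).symm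
      (Fintype.equivFin {k : Fin r // ¬ (e k).1 = p₀}).symm).trans (Equiv.sumCompl fun k : Fin r => (e k).1 = p₀)
  have hPl : ∀ x, (e (ec (Sum.inl x))).1 = p₀ := fun x => by
    simp only [ec, Equiv.trans_apply, Equiv.sumCongr_apply, Sum.map_inl, Equiv.sumCompl_apply_inl]
    exact ((Fintype.equivFin _).symm x).2
  have hPr : ∀ y, (e (ec (Sum.inr y))).1 ≠ p₀ := fun y => by
    simp only [ec, Equiv.trans_apply, Equiv.sumCongr_apply, Sum.map_inr, Equiv.sumCompl_apply_inr]
    exact ((Fintype.equivFin _).symm y).2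
  let wt : Fin r → ℕ := fun i => ∑ a ∈ u i, 2 ^ (a : ℕ)
  have hwt : Function.Injective wt := binaryWeight_injective u hu
  let σ : Equiv.Perm (Fin r) := Tuple.sort wt
  have hmono : Monotone (wt ∘ σ) := Tuple.monotone_sort wt
  let er : Fin n ⊕ Fin n' ≃ Fin r := (finSumFinEquiv.trans (finCongr hnn')).trans σ
  have hthr : ∀ x y, ∑ a ∈ u (er (Sum.inl x)), 2 ^ (a : ℕ) < ∑ a ∈ u (er (Sum.inr y)), 2 ^ (a : ℕ) := by
    intro x y
    have hidx : (finCongr hnn' (finSumFinEquiv (Sum.inl x)) : Fin r) < finCongr hnn' (finSumFinEquiv (Sum.inr y)) := by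
      rw [Fin.lt_def]
      simp only [finSumFinEquiv_apply_left, finSumFinEquiv_apply_right, finCongr_apply, Fin.val_cast,
        Fin.val_castAdd, Fin.val_natAdd]
      omega
    have hle : wt (σ (finCongr hnn' (finSumFinEquiv (Sum.inl x)))) ≤ wt (σ (finCongr hnn' (finSumFinEquiv (Sum.inr y)))) :=
      hmono hidx.le
    have hne : wt (σ (finCongr hnn' (finSumFinEquiv (Sum.inl x)))) ≠ wt (σ (finCongr hnn' (finSumFinEquiv (Sum.inr y)))) := by
      intro heq
      exact (ne_of_lt hidx) (σ.injective (hwt heq))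
    exact lt_of_le_of_ne hle hne
  have hcinj : Function.Injective fun x : Fin n => ec (Sum.inl x) :=
    fun x x' hx => Sum.inl_injective (ec.injective hx)
  have hcsurj : ∀ k, (e k).1 = p₀ → ∃ x : Fin n, ec (Sum.inl x) = k := by
    intro k hk
    rcases hz : ec.symm k with x | y
    · exact ⟨x, by rw [← hz, Equiv.apply_symm_apply]⟩
    · exact absurd (by rw [← Equiv.apply_symm_apply ec k, hz] at hk; exact hk) (hPr y)
  have hvinj : Function.Injective fun x : Fin n => u (er (Sum.inl x)) :=
    fun x x' hx => Sum.inl_injective (er.injective (hu hx))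
  obtain ⟨t, ht⟩ := hU p₀ n (fun x => ec (Sum.inl x)) hcinj hPl hcsurj (fun x => u (er (Sum.inl x))) hvinj
  have hu' : Function.Injective fun y : Fin n' => u (er (Sum.inr y)) :=
    fun y y' hy => Sum.inr_injective (er.injective (hu hy))
  have he' : Function.Injective fun y : Fin n' => e (ec (Sum.inr y)) :=
    fun y y' hy => Sum.inr_injective (ec.injective (he hy))
  have hU' : ∀ (p : Fin m) (n'' : ℕ) (c : Fin n'' → Fin n'), Function.Injective c →
      (∀ x, (e (ec (Sum.inr (c x)))).1 = p) → (∀ y, (e (ec (Sum.inr y))).1 = p → ∃ x, c x = y) →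
      ∀ v : Fin n'' → Finset (Fin h), Function.Injective v →
        ∃ t : Option (Fin K) → Fin h → ℂ,
          (Matrix.of fun x x' : Fin n'' => ∏ a ∈ v x,
            (t none a + ∑ q ∈ (e (ec (Sum.inr (c x')))).2, t (some q) a)).det ≠ 0 := by
    intro p n'' c hc hcp hcs v hv
    rcases Nat.eq_zero_or_pos n'' with h0 | h0
    · subst h0
      exact ⟨fun _ _ => 0, by rw [Matrix.det_isEmpty]; exact one_ne_zero⟩
    have hpp : p ≠ p₀ := by rw [← hcp ⟨0, h0⟩]; exact hPr _
    refine hU p n'' (fun x => ec (Sum.inr (c x))) (fun x x' hx => hc (Sum.inr_injective (ec.injective hx))) hcp ?_ v hv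
    intro k hk
    rcases hz : ec.symm k with x | y
    · have hx : (e (ec (Sum.inl x))).1 = p := by rw [← Equiv.apply_symm_apply ec k, hz] at hk; exact hk
      exact absurd (hx.symm.trans (hPl x)) hpp
    · have hy : (e (ec (Sum.inr y))).1 = p := by rw [← Equiv.apply_symm_apply ec k, hz] at hk; exact hk
      obtain ⟨x, hx⟩ := hcs y hy
      exact ⟨x, by rw [hx, ← hz, Equiv.apply_symm_apply]⟩
  obtain ⟨T', hT'⟩ := ih n' hlt (fun y => u (er (Sum.inr y))) (fun y => e (ec (Sum.inr y))) hu' he' hU'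
  exact good_of_absorb_join h m K r u e p₀ (fun a => 2 ^ (a : ℕ)) er ec hPl hPr hthr (fun _ => t) T' ht hT'

open Literature.Barriers.ValiantsHypothesis in
/-- **A legal wide design with uniform pieces serves EVERY layout of its size** (`b = 8`). For `h ≥ 3`, `m ≤ 2h` pieces and
`K ≤ h³` states: if the design `e` is a join threshold family for the weights `(W, wt)` and every piece of `e` is uniform, then
for EVERY pair of injective families `u, w : Fin r → Finset (Fin h)` some `f ∈ SmallCircuits ℂ (h+h) 8` has a nonzero partition
minor on `(u, w)` (`good_of_uniform_pieces_join` on both sides + the wide join door `HiddenStatesLine.stub_joinDoorWide`). -/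
theorem partitionMinor_hit_of_uniformJoin (h m K r : ℕ) (hh : 3 ≤ h) (hm : m ≤ h + h) (hK : K ≤ h * h * h)
    (u w : Fin r → Finset (Fin h)) (hu : Function.Injective u) (hw : Function.Injective w)
    (e : Fin r → Fin m × Finset (Fin K)) (he : Function.Injective e) (W : Fin m → ℕ) (wt : Fin m → Fin K → ℕ)
    (hthr : ∀ x : Fin m × Finset (Fin K), x ∉ Set.range e →
      ∀ i, W (e i).1 + ∑ k ∈ (e i).2, wt (e i).1 k < W x.1 + ∑ k ∈ x.2, wt x.1 k)
    (hU : ∀ (p : Fin m) (n : ℕ) (c : Fin n → Fin r), Function.Injective c → (∀ x, (e (c x)).1 = p) →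
      (∀ k, (e k).1 = p → ∃ x, c x = k) → ∀ v : Fin n → Finset (Fin h), Function.Injective v →
        ∃ t : Option (Fin K) → Fin h → ℂ,
          (Matrix.of fun x x' : Fin n => ∏ a ∈ v x,
            (t none a + ∑ q ∈ (e (c x')).2, t (some q) a)).det ≠ 0) :
    ∃ f ∈ SmallCircuits ℂ (h + h) 8,
      (Matrix.of fun i j : Fin r => MvPolynomial.coeff
        (∑ a ∈ u i, Finsupp.single (Fin.castAdd h a) 1 +
          ∑ c ∈ w j, Finsupp.single (Fin.natAdd h c) 1) f).det ≠ 0 := by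
  obtain ⟨tx, hx⟩ := good_of_uniform_pieces_join h m K r u e hu he hU
  obtain ⟨ty, hy⟩ := good_of_uniform_pieces_join h m K r w e hw he hU
  exact HiddenStatesLine.stub_joinDoorWide h m K r hh hm hK u w e he W wt hthr tx ty hx hy

end Summit.ValiantsHypothesis.ValiantsHypothesis.Theorems.BarrierLever.SimplexJoin
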